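import Summits.CriticalPhenomena.PercolationContinuityZ3.Theorems.PercNearOneGluingNoHeavyLowerTailSahiLatinZeroBottomRelaxedCoreChainD
import Summits.CriticalPhenomena.PercolationContinuityZ3.Theorems.PercNearOneGluingNoHeavyLowerTailSahiLatinZeroBottomRelaxedBridge

/-!
# `NoHeavyLowerTail` (crux stmt-CriticalPhenomena-4575), Sahi programme (prim-master-conj gen 50): **THE RELAXED GENERAL CORE** — `Grid4`, hence TOP₁ with the
# sharp constant `3/2`, for `P = [x₀=2]×S×Ω ⊂ P′ = [x₀≥1]×Ω`, `Q = Ω×Ω×T` with ARBITRARY `S ⊆ [3]^U`, `T ⊆ [3]^V` (a threshold-relaxed literal together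
# with an arbitrary private cut), and the family it generates under arbitrary up-set factor lifts

Support file (`--supports stmt-CriticalPhenomena-4575`; small definitions (`mRC`, the family `IsRelCorePad`) + proofs, no `sorry`, standard axioms).  Memo
`run/shared/lean/prim/prim-l12/FROM-prim-master-conj-g50-GENERAL-CORE.md` §9.  Nothing here asserts the crux, Kahn's conjecture or (C¼).

THE MATHEMATICS (memo §9).  With `a = N_{Sᶜ}(ξ)` for `ξ ∈ S`, `a′ = N_S(ξ)` for `ξ ∉ S` (cross-degrees of the cut `S` of `K₃^{⊗U}`), `b = N_{Tᶜ}(η)` for `η ∈ T`,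
`b′ = N_T(η)` for `η ∉ T`, `X = 2^{|U|}`, `Y = 2^{|V|}`, the `x₀`-chain minimum is bounded below by (`mRC`, `mRC_le`, from the chain files A–D)
  `m = min(−2aY − 2Xb − 8ab, 2XY − 2aY − 6Xb)` (`ξ∈S, η∈T`), `X·min(4Y−2β̄, 7Y−6β̄)` (`ξ∈S, η∉T`), `2a′Y + min(8a′b, 4XY, 2XY + 4Xb)` (`ξ∉S, η∈T`), `0` (else),
and `Σ_{ξ,η} m ≥ XY·|S|·|Tᶜ| ≥ 0` (`sum_mRC_nonneg`): the `±2aY|T|` and `8ab` masses cancel exactly (`Σ_{ξ∈S}a = Σ_{ξ∉S}a′`, `Σ_{η∈T}b = Σ_{η∉T}b′`), leaving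
`2XY|S||Tᶜ| − E₁ − X|S|E′ − E₃`; per `η ∈ T` the excesses satisfy `Σ_{ξ∈S}(4Xb−8ab−2XY)⁺ + Σ_{ξ∉S}(8a′b − min(4XY,2XY+4Xb))⁺ ≤ 2X|S|(2b−Y)⁺` (`excess_le`: four
elementary inequalities + the ONE-BLOCK LEMMA on `S`), and the one-block lemma on `T` converts `Σ_{η∈T}(2b−Y)⁺` into `Σ_{η∉T} min(b′, Y−b′)`.  Hence
`grid4_relaxedCore` (by `grid4_of_fibrewise`, exact along `x₀`), the family `IsRelCorePad` (relaxed general cores + factor lifts) and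
**`three_kappa_top_le_two_kappa_lowerStep_of_isRelCorePad`**: TOP₁(3/2) for `P = A×[x₀=2]×P_U ⊂ P′ = A×[x₀≥1]×Ω` (threshold-relaxed literal + private cut
inside an arbitrary common prime `A`), `Q′ = B×Ω ⊃ Q = B×Q_V`, every dimension.  HONEST LABEL: general non-private cuts ((HC) of the memo), shared primes, (C¼),
TOP₁, FBP(d ≥ 5), Kahn remain OPEN. [this work]
-/

namespace Summit.CriticalPhenomena.PercolationContinuityZ3.Theorems.SahiLatin

open Finset

section inst
variable {U V : Type} [Fintype U] [DecidableEq U] [Fintype V] [DecidableEq V] (S : Finset (Pt U)) (T : Finset (Pt V))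

/-! ## §1  The chain bound and its verification -/

/-- The lower bound `m(ξ,η)` of the `x₀`-chain problem of the relaxed general core. [this work] -/
def mRC (ξ : Pt U) (η : Pt V) : ℤ :=
  if ξ ∈ S then
    (if η ∈ T then
      min (-2 * (N Sᶜ ξ : ℤ) * 2 ^ Fintype.card V - 2 * 2 ^ Fintype.card U * (N Tᶜ η : ℤ) - 8 * (N Sᶜ ξ : ℤ) * (N Tᶜ η : ℤ))
        (2 * 2 ^ Fintype.card U * 2 ^ Fintype.card V - 2 * (N Sᶜ ξ : ℤ) * 2 ^ Fintype.card V - 6 * 2 ^ Fintype.card U * (N Tᶜ η : ℤ))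
     else 2 ^ Fintype.card U * min (4 * 2 ^ Fintype.card V - 2 * (N Tᶜ η : ℤ)) (7 * 2 ^ Fintype.card V - 6 * (N Tᶜ η : ℤ)))
  else
    (if η ∈ T then
      2 * (N S ξ : ℤ) * 2 ^ Fintype.card V + min (8 * (N S ξ : ℤ) * (N Tᶜ η : ℤ))
        (min (4 * 2 ^ Fintype.card U * 2 ^ Fintype.card V) (2 * 2 ^ Fintype.card U * 2 ^ Fintype.card V + 4 * 2 ^ Fintype.card U * (N Tᶜ η : ℤ)))
     else 0)

/-- **The chain inequalities** (assembly of files A–D): `mRC` is below the chain value of every admissible nested family of up-sets of `[3]^{Fin 1}`. [this work] -/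
theorem mRC_le (ξ : Pt U) (η : Pt V) (JSS JSO JOS JOO : Finset (Pt (Fin 1)))
    (uSS : IsUpperSet (JSS : Set (Pt (Fin 1)))) (uSO : IsUpperSet (JSO : Set (Pt (Fin 1)))) (uOS : IsUpperSet (JOS : Set (Pt (Fin 1))))
    (uOO : IsUpperSet (JOO : Set (Pt (Fin 1)))) (n1 : JOO ⊆ JSO) (n2 : JOO ⊆ JOS) (n3 : JSO ⊆ JSS) (n4 : JOS ⊆ JSS)
    (f1 : ∀ w, Sum.elim w (Sum.elim ξ η) ∈ rcP S ∪ rcQ T → w ∈ JSS) (f2 : ∀ w, Sum.elim w (Sum.elim ξ η) ∈ rcP S → w ∈ JSO)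
    (f3 : ∀ w, Sum.elim w (Sum.elim ξ η) ∈ rcQ T → w ∈ JOS) :
    mRC S T ξ η ≤
      ∑ w ∈ JSS, dSS (rcP S) (rcb S) (rcQ T) (rcc T) (Sum.elim w (Sum.elim ξ η))
      + ∑ w ∈ JSO, dSO (rcP S) (rcb S) (rcQ T) (rcc T) (Sum.elim w (Sum.elim ξ η))
      + ∑ w ∈ JOS, dOS (rcP S) (rcb S) (rcQ T) (rcc T) (Sum.elim w (Sum.elim ξ η))
      + ∑ w ∈ JOO, dOO (rcP S) (rcb S) (rcQ T) (rcc T) (Sum.elim w (Sum.elim ξ η)) := by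
  have hPmem : ξ ∈ S → Sum.elim (pt1 2) (Sum.elim ξ η) ∈ rcP S := fun hS => by
    rw [rcP, mem_inter, mem_cylL, mem_cylR, fstPt_elim, sndPt_elim, mem_cylL, fstPt_elim]
    exact ⟨by simp [lvl, pt1], hS⟩
  have hQmem : η ∈ T → ∀ w : Pt (Fin 1), Sum.elim w (Sum.elim ξ η) ∈ rcQ T := fun hT w => by
    rw [rcQ, mem_cylR, sndPt_elim, mem_cylR, sndPt_elim]; exact hT
  unfold mRC
  by_cases hS : ξ ∈ S <;> by_cases hT : η ∈ T
  · rw [if_pos hS, if_pos hT]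
    have h2SO : pt1 2 ∈ JSO := f2 _ (hPmem hS)
    have hSS : JSS = univ := eq_univ_of_forall fun w => f1 w (mem_union_right _ (hQmem hT w))
    have hOS : JOS = univ := eq_univ_of_forall fun w => f3 w (hQmem hT w)
    subst hSS; subst hOS
    exact mRC_le_inS_inT S T hS hT uSO uOO n1 h2SO
  · rw [if_pos hS, if_neg hT]
    have h2SO : pt1 2 ∈ JSO := f2 _ (hPmem hS)
    have h2SS : pt1 2 ∈ JSS := n3 h2SO
    rcases upperSet_pt1_cases JSS uSS with h | h | h | h
    · subst h; exact absurd h2SS (by simp)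
    · subst h; exact mRC_le_inS_outT_two S T hS hT uSO uOS uOO n1 n2 n3 n4 h2SO
    · subst h; exact mRC_le_inS_outT_onetwo S T hS hT uSO uOS uOO n1 n2 n3 n4 h2SO
    · subst h; exact mRC_le_inS_outT_univ S T hS hT uSO uOS uOO n1 n2 n3 n4 h2SO
  · rw [if_neg hS, if_pos hT]
    have hSS : JSS = univ := eq_univ_of_forall fun w => f1 w (mem_union_right _ (hQmem hT w))
    have hOS : JOS = univ := eq_univ_of_forall fun w => f3 w (hQmem hT w)
    subst hSS; subst hOS
    exact mRC_le_outS_inT S T hS hT uSO uOO n1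
  · rw [if_neg hS, if_neg hT]
    rcases upperSet_pt1_cases JSS uSS with h | h | h | h
    · subst h; exact mRC_le_outS_outT_empty S T hS hT uSO uOS uOO n1 n2 n3 n4
    · subst h; exact mRC_le_outS_outT_two S T hS hT uSO uOS uOO n1 n2 n3 n4
    · subst h; exact mRC_le_outS_outT_onetwo S T hS hT uSO uOS uOO n1 n2 n3 n4
    · subst h; exact mRC_le_outS_outT_univ S T hS hT uSO uOS uOO n1 n2 n3 n4

/-! ## §2  Elementary inequalities for the sum -/

omit [Fintype U] [DecidableEq U] [Fintype V] [DecidableEq V] in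
/-- `p − (p − q)⁺ ≤ min p q` (indeed equality). [this work] -/
theorem sub_posPart_le_min (p q : ℤ) : p - max (p - q) 0 ≤ min p q := by
  rcases le_or_gt p q with h | h
  · rw [max_eq_right (by linarith), min_eq_left h]; linarith
  · rw [max_eq_left (by linarith), min_eq_right h.le]; linarith

omit [Fintype U] [DecidableEq U] [Fintype V] [DecidableEq V] in
/-- (i): `(8a′b − 4XY)⁺ ≤ 4(2b − Y)(2a′ − X)⁺` for `0 ≤ a′ ≤ X`, `0 ≤ b ≤ Y`, `Y ≤ 2b`. [this work] -/
theorem ineq_i {a X b Y : ℤ} (ha : 0 ≤ a) (haX : a ≤ X) (hb : 0 ≤ b) (hbY : b ≤ Y) (h2 : Y ≤ 2 * b) :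
    max (8 * a * b - 4 * X * Y) 0 ≤ 4 * (2 * b - Y) * max (2 * a - X) 0 := by
  rcases le_or_gt (2 * a) X with h | h
  · rw [max_eq_right (by linarith : 2 * a - X ≤ 0)]
    have : 8 * a * b - 4 * X * Y ≤ 0 := by nlinarith
    rw [max_eq_right this, mul_zero]
  · rw [max_eq_left (by linarith : 0 ≤ 2 * a - X)]
    refine max_le ?_ (by nlinarith)
    nlinarith [mul_nonneg (sub_nonneg.2 haX) (sub_nonneg.2 hbY)]

omit [Fintype U] [DecidableEq U] [Fintype V] [DecidableEq V] in
/-- (ii)+(iv): `4(2b − Y)(a − (2a − X)⁺) ≤ min(2X(2b − Y), 8ab)` for `0 ≤ a ≤ X`, `0 ≤ Y ≤ 2b`. [this work] -/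
theorem ineq_ii {a X b Y : ℤ} (ha : 0 ≤ a) (_haX : a ≤ X) (hY : 0 ≤ Y) (h2 : Y ≤ 2 * b) :
    4 * (2 * b - Y) * (a - max (2 * a - X) 0) ≤ min (2 * X * (2 * b - Y)) (8 * a * b) := by
  have h2b : 0 ≤ 2 * b - Y := by linarith
  rcases le_or_gt (2 * a) X with h | h
  · rw [max_eq_right (by linarith : 2 * a - X ≤ 0), sub_zero]
    exact le_min (by nlinarith) (by nlinarith)
  · rw [max_eq_left (by linarith : 0 ≤ 2 * a - X)]
    exact le_min (by nlinarith) (by nlinarith)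

omit [Fintype U] [DecidableEq U] [Fintype V] [DecidableEq V] in
/-- `(Y − 4c)⁺ + 2(c − (2c − Y)⁺) ≤ Y` for `0 ≤ c ≤ Y`. [this work] -/
theorem psi2_bound {c Y : ℤ} (h0 : 0 ≤ c) (hY : c ≤ Y) : max (Y - 4 * c) 0 + 2 * (c - max (2 * c - Y) 0) ≤ Y := by
  rcases le_or_gt (4 * c) Y with h1 | h1 <;> rcases le_or_gt (2 * c) Y with h2 | h2
  · rw [max_eq_left (by linarith), max_eq_right (by linarith)]; linarith
  · rw [max_eq_left (by linarith), max_eq_left (by linarith)]; linarith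
  · rw [max_eq_right (by linarith), max_eq_right (by linarith)]; linarith
  · rw [max_eq_right (by linarith), max_eq_left (by linarith)]; linarith

omit [DecidableEq V] in
/-- **The excess inequality** (the heart of the sum bound): for `0 ≤ b ≤ 2^q`,
`Σ_{ξ∈S}(4Xb − 8N_{Sᶜ}(ξ)b − 2XY)⁺ + Σ_{ξ∉S}(8N_S(ξ)b − min(4XY, 2XY + 4Xb))⁺ ≤ 2X·|S|·(2b − Y)⁺` (one-block lemma on `S`). [this work] -/
theorem excess_le {b : ℤ} (hb : 0 ≤ b) (hbY : b ≤ 2 ^ Fintype.card V) :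
    ∑ ξ ∈ S, max (4 * 2 ^ Fintype.card U * b - 8 * (N Sᶜ ξ : ℤ) * b - 2 * 2 ^ Fintype.card U * 2 ^ Fintype.card V) 0
      + ∑ ξ ∈ Sᶜ, max (8 * (N S ξ : ℤ) * b - min (4 * 2 ^ Fintype.card U * 2 ^ Fintype.card V)
          (2 * 2 ^ Fintype.card U * 2 ^ Fintype.card V + 4 * 2 ^ Fintype.card U * b)) 0
      ≤ 2 * 2 ^ Fintype.card U * S.card * max (2 * b - 2 ^ Fintype.card V) 0 := by
  have hX : (0 : ℤ) < 2 ^ Fintype.card U := by positivity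
  have hY : (0 : ℤ) < 2 ^ Fintype.card V := by positivity
  by_cases h2 : 2 * b ≤ 2 ^ Fintype.card V
  · rw [max_eq_right (by linarith : 2 * b - 2 ^ Fintype.card V ≤ 0), mul_zero]
    have z1 : ∀ ξ ∈ S, max (4 * 2 ^ Fintype.card U * b - 8 * (N Sᶜ ξ : ℤ) * b - 2 * 2 ^ Fintype.card U * 2 ^ Fintype.card V) 0 = 0 := by
      intro ξ _
      have : (0 : ℤ) ≤ N Sᶜ ξ := by positivity
      exact max_eq_right (by nlinarith)
    have z2 : ∀ ξ ∈ Sᶜ, max (8 * (N S ξ : ℤ) * b - min (4 * 2 ^ Fintype.card U * 2 ^ Fintype.card V)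
        (2 * 2 ^ Fintype.card U * 2 ^ Fintype.card V + 4 * 2 ^ Fintype.card U * b)) 0 = 0 := by
      intro ξ _
      have h0 : (0 : ℤ) ≤ N S ξ := by positivity
      have h1 : (N S ξ : ℤ) ≤ 2 ^ Fintype.card U := by exact_mod_cast N_le S ξ
      refine max_eq_right (sub_nonpos.2 (le_min (by nlinarith) (by nlinarith)))
    rw [sum_congr rfl z1, sum_congr rfl z2, sum_const_zero, sum_const_zero, add_zero]
  · rw [not_le] at h2
    rw [max_eq_left (by linarith : 0 ≤ 2 * b - 2 ^ Fintype.card V)]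
    have emin : min (4 * 2 ^ Fintype.card U * 2 ^ Fintype.card V : ℤ) (2 * 2 ^ Fintype.card U * 2 ^ Fintype.card V + 4 * 2 ^ Fintype.card U * b)
        = 4 * 2 ^ Fintype.card U * 2 ^ Fintype.card V := min_eq_left (by nlinarith)
    simp only [emin]
    -- step A: the `ξ ∈ S` excess
    have eA : ∀ ξ ∈ S, max (4 * 2 ^ Fintype.card U * b - 8 * (N Sᶜ ξ : ℤ) * b - 2 * 2 ^ Fintype.card U * 2 ^ Fintype.card V) 0
        = 2 * 2 ^ Fintype.card U * (2 * b - 2 ^ Fintype.card V) - min (2 * 2 ^ Fintype.card U * (2 * b - 2 ^ Fintype.card V)) (8 * (N Sᶜ ξ : ℤ) * b) := by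
      intro ξ _
      rcases le_or_gt (2 * 2 ^ Fintype.card U * (2 * b - 2 ^ Fintype.card V)) (8 * (N Sᶜ ξ : ℤ) * b) with h | h
      · rw [min_eq_left h, max_eq_right (by linarith)]; ring
      · rw [min_eq_right h.le, max_eq_left (by linarith)]; ring
    rw [sum_congr rfl eA, sum_sub_distrib, sum_const, nsmul_eq_mul]
    -- step B: the `ξ ∉ S` excess is at most the subtracted sum
    have eB1 : ∑ ξ ∈ Sᶜ, max (8 * (N S ξ : ℤ) * b - 4 * 2 ^ Fintype.card U * 2 ^ Fintype.card V) 0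
        ≤ ∑ ξ ∈ Sᶜ, 4 * (2 * b - 2 ^ Fintype.card V) * max (2 * (N S ξ : ℤ) - 2 ^ Fintype.card U) 0 :=
      sum_le_sum fun ξ _ => ineq_i (by positivity) (by exact_mod_cast N_le S ξ) hb hbY h2.le
    have ob := sum_posPart_cross_le S
    have eB2 : ∑ ξ ∈ S, 4 * (2 * b - 2 ^ Fintype.card V) * ((N Sᶜ ξ : ℤ) - max (2 * (N Sᶜ ξ : ℤ) - 2 ^ Fintype.card U) 0)
        ≤ ∑ ξ ∈ S, min (2 * 2 ^ Fintype.card U * (2 * b - 2 ^ Fintype.card V)) (8 * (N Sᶜ ξ : ℤ) * b) :=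
      sum_le_sum fun ξ _ => ineq_ii (by positivity) (by exact_mod_cast N_le Sᶜ ξ) hY.le h2.le
    rw [← mul_sum] at eB1
    have eB2' : ∑ ξ ∈ S, 4 * (2 * b - 2 ^ Fintype.card V) * ((N Sᶜ ξ : ℤ) - max (2 * (N Sᶜ ξ : ℤ) - 2 ^ Fintype.card U) 0)
        = 4 * (2 * b - 2 ^ Fintype.card V) * (∑ ξ ∈ S, (N Sᶜ ξ : ℤ) - ∑ ξ ∈ S, max (2 * (N Sᶜ ξ : ℤ) - 2 ^ Fintype.card U) 0) := by
      rw [← mul_sum, sum_sub_distrib]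
    have h2b : (0 : ℤ) ≤ 4 * (2 * b - 2 ^ Fintype.card V) := by linarith
    have eB3 := mul_le_mul_of_nonneg_left ob h2b
    rw [mul_add] at eB3
    rw [eB2'] at eB2
    linarith [eB1, eB2, eB3]

/-! ## §3  The sum of the chain bounds -/

/-- The total of `mRC`, split by the three nonzero membership regions. [this work] -/
theorem sum_mRC_eq :
    ∑ x : Pt (U ⊕ V), mRC S T (fstPt x) (sndPt x) =
      ∑ ξ ∈ S, ∑ η ∈ T, min (-2 * (N Sᶜ ξ : ℤ) * 2 ^ Fintype.card V - 2 * 2 ^ Fintype.card U * (N Tᶜ η : ℤ) - 8 * (N Sᶜ ξ : ℤ) * (N Tᶜ η : ℤ))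
          (2 * 2 ^ Fintype.card U * 2 ^ Fintype.card V - 2 * (N Sᶜ ξ : ℤ) * 2 ^ Fintype.card V - 6 * 2 ^ Fintype.card U * (N Tᶜ η : ℤ))
      + ∑ _ξ ∈ S, ∑ η ∈ Tᶜ, 2 ^ Fintype.card U * min (4 * 2 ^ Fintype.card V - 2 * (N Tᶜ η : ℤ)) (7 * 2 ^ Fintype.card V - 6 * (N Tᶜ η : ℤ))
      + ∑ ξ ∈ Sᶜ, ∑ η ∈ T, (2 * (N S ξ : ℤ) * 2 ^ Fintype.card V + min (8 * (N S ξ : ℤ) * (N Tᶜ η : ℤ))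
          (min (4 * 2 ^ Fintype.card U * 2 ^ Fintype.card V) (2 * 2 ^ Fintype.card U * 2 ^ Fintype.card V + 4 * 2 ^ Fintype.card U * (N Tᶜ η : ℤ)))) := by
  rw [sum_pt_sum_eq, ← sum_add_sum_compl S, ← sum_add_distrib]
  simp only [fstPt_elim, sndPt_elim]
  congr 1
  · refine sum_congr rfl fun ξ hξ => ?_
    rw [← sum_add_sum_compl T]
    congr 1
    · exact sum_congr rfl fun η hη => by simp [mRC, hξ, hη]
    · exact sum_congr rfl fun η hη => by rw [mem_compl] at hη; simp [mRC, hξ, hη]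
  · refine sum_congr rfl fun ξ hξ => ?_
    rw [mem_compl] at hξ
    rw [← sum_add_sum_compl T]
    have h0 : ∑ η ∈ Tᶜ, mRC S T ξ η = 0 := sum_eq_zero fun η hη => by rw [mem_compl] at hη; simp [mRC, hξ, hη]
    rw [h0, add_zero]
    exact sum_congr rfl fun η hη => by simp [mRC, hξ, hη]

/-- **The chain bounds have nonnegative total**: `Σ_{(ξ,η)} mRC ≥ 0` (indeed `≥ 2^p 2^q |S| |Tᶜ|`). [this work] -/
theorem sum_mRC_nonneg : 0 ≤ ∑ x : Pt (U ⊕ V), mRC S T (fstPt x) (sndPt x) := by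
  rw [sum_mRC_eq]
  have hX : (0 : ℤ) < 2 ^ Fintype.card U := by positivity
  have hY : (0 : ℤ) < 2 ^ Fintype.card V := by positivity
  -- pointwise lower bounds of the three minima
  have L11 : ∀ ξ ∈ S, ∀ η ∈ T,
      (-2 * (N Sᶜ ξ : ℤ) * 2 ^ Fintype.card V - 2 * 2 ^ Fintype.card U * (N Tᶜ η : ℤ) - 8 * (N Sᶜ ξ : ℤ) * (N Tᶜ η : ℤ))
        - max (4 * 2 ^ Fintype.card U * (N Tᶜ η : ℤ) - 8 * (N Sᶜ ξ : ℤ) * (N Tᶜ η : ℤ) - 2 * 2 ^ Fintype.card U * 2 ^ Fintype.card V) 0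
      ≤ min (-2 * (N Sᶜ ξ : ℤ) * 2 ^ Fintype.card V - 2 * 2 ^ Fintype.card U * (N Tᶜ η : ℤ) - 8 * (N Sᶜ ξ : ℤ) * (N Tᶜ η : ℤ))
          (2 * 2 ^ Fintype.card U * 2 ^ Fintype.card V - 2 * (N Sᶜ ξ : ℤ) * 2 ^ Fintype.card V - 6 * 2 ^ Fintype.card U * (N Tᶜ η : ℤ)) := by
    intro ξ _ η _
    have h := sub_posPart_le_min (-2 * (N Sᶜ ξ : ℤ) * 2 ^ Fintype.card V - 2 * 2 ^ Fintype.card U * (N Tᶜ η : ℤ) - 8 * (N Sᶜ ξ : ℤ) * (N Tᶜ η : ℤ))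
      (2 * 2 ^ Fintype.card U * 2 ^ Fintype.card V - 2 * (N Sᶜ ξ : ℤ) * 2 ^ Fintype.card V - 6 * 2 ^ Fintype.card U * (N Tᶜ η : ℤ))
    have e : (-2 * (N Sᶜ ξ : ℤ) * 2 ^ Fintype.card V - 2 * 2 ^ Fintype.card U * (N Tᶜ η : ℤ) - 8 * (N Sᶜ ξ : ℤ) * (N Tᶜ η : ℤ))
        - (2 * 2 ^ Fintype.card U * 2 ^ Fintype.card V - 2 * (N Sᶜ ξ : ℤ) * 2 ^ Fintype.card V - 6 * 2 ^ Fintype.card U * (N Tᶜ η : ℤ))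
        = 4 * 2 ^ Fintype.card U * (N Tᶜ η : ℤ) - 8 * (N Sᶜ ξ : ℤ) * (N Tᶜ η : ℤ) - 2 * 2 ^ Fintype.card U * 2 ^ Fintype.card V := by ring
    rw [e] at h; exact h
  have L10 : ∀ η ∈ Tᶜ, 2 ^ Fintype.card U * (2 * 2 ^ Fintype.card V + 2 * (N T η : ℤ)) - 2 ^ Fintype.card U * max (2 ^ Fintype.card V - 4 * (N T η : ℤ)) 0
      ≤ 2 ^ Fintype.card U * min (4 * 2 ^ Fintype.card V - 2 * (N Tᶜ η : ℤ)) (7 * 2 ^ Fintype.card V - 6 * (N Tᶜ η : ℤ)) := by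
    intro η _
    have e : (N Tᶜ η : ℤ) = 2 ^ Fintype.card V - N T η := by
      have h' : (N T η : ℤ) + N Tᶜ η = 2 ^ Fintype.card V := by exact_mod_cast N_add_N_compl T η
      linarith
    rw [e, ← mul_sub]
    refine mul_le_mul_of_nonneg_left ?_ hX.le
    have h := sub_posPart_le_min (2 * 2 ^ Fintype.card V + 2 * (N T η : ℤ)) (2 ^ Fintype.card V + 6 * (N T η : ℤ))
    have e1 : (4 * 2 ^ Fintype.card V - 2 * (2 ^ Fintype.card V - (N T η : ℤ))) = 2 * 2 ^ Fintype.card V + 2 * (N T η : ℤ) := by ring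
    have e2 : (7 * 2 ^ Fintype.card V - 6 * (2 ^ Fintype.card V - (N T η : ℤ))) = 2 ^ Fintype.card V + 6 * (N T η : ℤ) := by ring
    have e3 : 2 * 2 ^ Fintype.card V + 2 * (N T η : ℤ) - (2 ^ Fintype.card V + 6 * (N T η : ℤ)) = 2 ^ Fintype.card V - 4 * (N T η : ℤ) := by ring
    rw [e1, e2]; rw [e3] at h; exact h
  have L01 : ∀ ξ ∈ Sᶜ, ∀ η ∈ T,
      2 * (N S ξ : ℤ) * 2 ^ Fintype.card V + 8 * (N S ξ : ℤ) * (N Tᶜ η : ℤ)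
        - max (8 * (N S ξ : ℤ) * (N Tᶜ η : ℤ) - min (4 * 2 ^ Fintype.card U * 2 ^ Fintype.card V)
            (2 * 2 ^ Fintype.card U * 2 ^ Fintype.card V + 4 * 2 ^ Fintype.card U * (N Tᶜ η : ℤ))) 0
      ≤ 2 * (N S ξ : ℤ) * 2 ^ Fintype.card V + min (8 * (N S ξ : ℤ) * (N Tᶜ η : ℤ))
          (min (4 * 2 ^ Fintype.card U * 2 ^ Fintype.card V) (2 * 2 ^ Fintype.card U * 2 ^ Fintype.card V + 4 * 2 ^ Fintype.card U * (N Tᶜ η : ℤ))) := by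
    intro ξ _ η _
    have h := sub_posPart_le_min (8 * (N S ξ : ℤ) * (N Tᶜ η : ℤ))
      (min (4 * 2 ^ Fintype.card U * 2 ^ Fintype.card V) (2 * 2 ^ Fintype.card U * 2 ^ Fintype.card V + 4 * 2 ^ Fintype.card U * (N Tᶜ η : ℤ)))
    linarith
  -- sum the lower bounds
  have S11 := sum_le_sum fun ξ (hξ : ξ ∈ S) => sum_le_sum fun η (hη : η ∈ T) => L11 ξ hξ η hη
  have S10 := sum_le_sum fun (_x : Pt U) (_ : _x ∈ S) => sum_le_sum fun η (hη : η ∈ Tᶜ) => L10 η hη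
  have S01 := sum_le_sum fun ξ (hξ : ξ ∈ Sᶜ) => sum_le_sum fun η (hη : η ∈ T) => L01 ξ hξ η hη
  -- the excesses, summed over η ∈ T after swapping the order of summation
  have EX : ∑ η ∈ T, (∑ ξ ∈ S, max (4 * 2 ^ Fintype.card U * (N Tᶜ η : ℤ) - 8 * (N Sᶜ ξ : ℤ) * (N Tᶜ η : ℤ) - 2 * 2 ^ Fintype.card U * 2 ^ Fintype.card V) 0
      + ∑ ξ ∈ Sᶜ, max (8 * (N S ξ : ℤ) * (N Tᶜ η : ℤ) - min (4 * 2 ^ Fintype.card U * 2 ^ Fintype.card V)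
          (2 * 2 ^ Fintype.card U * 2 ^ Fintype.card V + 4 * 2 ^ Fintype.card U * (N Tᶜ η : ℤ))) 0)
      ≤ ∑ η ∈ T, 2 * 2 ^ Fintype.card U * S.card * max (2 * (N Tᶜ η : ℤ) - 2 ^ Fintype.card V) 0 :=
    sum_le_sum fun η _ => excess_le S (by positivity) (by exact_mod_cast N_le Tᶜ η)
  rw [sum_add_distrib, sum_comm, ← mul_sum] at EX
  have EXc : ∑ η ∈ T, ∑ ξ ∈ Sᶜ, max (8 * (N S ξ : ℤ) * (N Tᶜ η : ℤ) - min (4 * 2 ^ Fintype.card U * 2 ^ Fintype.card V)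
          (2 * 2 ^ Fintype.card U * 2 ^ Fintype.card V + 4 * 2 ^ Fintype.card U * (N Tᶜ η : ℤ))) 0
      = ∑ ξ ∈ Sᶜ, ∑ η ∈ T, max (8 * (N S ξ : ℤ) * (N Tᶜ η : ℤ) - min (4 * 2 ^ Fintype.card U * 2 ^ Fintype.card V)
          (2 * 2 ^ Fintype.card U * 2 ^ Fintype.card V + 4 * 2 ^ Fintype.card U * (N Tᶜ η : ℤ))) 0 := sum_comm
  rw [EXc] at EX
  -- the one-block lemma on `T` and the pointwise bound `psi2_bound`
  have obT := sum_posPart_cross_le T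
  have PS : ∑ η ∈ Tᶜ, (max (2 ^ Fintype.card V - 4 * (N T η : ℤ)) 0 + 2 * ((N T η : ℤ) - max (2 * (N T η : ℤ) - 2 ^ Fintype.card V) 0))
      ≤ ∑ η ∈ Tᶜ, (2 : ℤ) ^ Fintype.card V :=
    sum_le_sum fun η _ => psi2_bound (by positivity) (by exact_mod_cast N_le T η)
  rw [sum_const, nsmul_eq_mul, sum_add_distrib, ← mul_sum, sum_sub_distrib] at PS
  have eB := sum_N_comm T Tᶜ
  have eA := sum_N_comm S Sᶜ
  -- closed forms of the linear parts
  have R11 : ∑ ξ ∈ S, ∑ η ∈ T, ((-2 * (N Sᶜ ξ : ℤ) * 2 ^ Fintype.card V - 2 * 2 ^ Fintype.card U * (N Tᶜ η : ℤ) - 8 * (N Sᶜ ξ : ℤ) * (N Tᶜ η : ℤ))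
        - max (4 * 2 ^ Fintype.card U * (N Tᶜ η : ℤ) - 8 * (N Sᶜ ξ : ℤ) * (N Tᶜ η : ℤ) - 2 * 2 ^ Fintype.card U * 2 ^ Fintype.card V) 0)
      = -2 * 2 ^ Fintype.card V * T.card * (∑ ξ ∈ S, (N Sᶜ ξ : ℤ)) - 2 * 2 ^ Fintype.card U * S.card * (∑ η ∈ T, (N Tᶜ η : ℤ))
        - 8 * ((∑ ξ ∈ S, (N Sᶜ ξ : ℤ)) * (∑ η ∈ T, (N Tᶜ η : ℤ)))
        - ∑ ξ ∈ S, ∑ η ∈ T, max (4 * 2 ^ Fintype.card U * (N Tᶜ η : ℤ) - 8 * (N Sᶜ ξ : ℤ) * (N Tᶜ η : ℤ) - 2 * 2 ^ Fintype.card U * 2 ^ Fintype.card V) 0 := by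
    simp only [sum_sub_distrib, sum_const, nsmul_eq_mul, ← mul_sum, ← sum_mul]
    ring
  have R10 : ∑ _ξ ∈ S, ∑ η ∈ Tᶜ, (2 ^ Fintype.card U * (2 * 2 ^ Fintype.card V + 2 * (N T η : ℤ)) - 2 ^ Fintype.card U * max (2 ^ Fintype.card V - 4 * (N T η : ℤ)) 0)
      = 2 * 2 ^ Fintype.card U * 2 ^ Fintype.card V * S.card * Tᶜ.card + 2 * 2 ^ Fintype.card U * S.card * (∑ η ∈ Tᶜ, (N T η : ℤ))
        - 2 ^ Fintype.card U * S.card * ∑ η ∈ Tᶜ, max (2 ^ Fintype.card V - 4 * (N T η : ℤ)) 0 := by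
    simp only [sum_sub_distrib, sum_add_distrib, mul_add, sum_const, nsmul_eq_mul, ← mul_sum]
    ring
  have R01 : ∑ ξ ∈ Sᶜ, ∑ η ∈ T, (2 * (N S ξ : ℤ) * 2 ^ Fintype.card V + 8 * (N S ξ : ℤ) * (N Tᶜ η : ℤ)
        - max (8 * (N S ξ : ℤ) * (N Tᶜ η : ℤ) - min (4 * 2 ^ Fintype.card U * 2 ^ Fintype.card V)
            (2 * 2 ^ Fintype.card U * 2 ^ Fintype.card V + 4 * 2 ^ Fintype.card U * (N Tᶜ η : ℤ))) 0)
      = 2 * 2 ^ Fintype.card V * T.card * (∑ ξ ∈ Sᶜ, (N S ξ : ℤ)) + 8 * ((∑ ξ ∈ Sᶜ, (N S ξ : ℤ)) * (∑ η ∈ T, (N Tᶜ η : ℤ)))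
        - ∑ ξ ∈ Sᶜ, ∑ η ∈ T, max (8 * (N S ξ : ℤ) * (N Tᶜ η : ℤ) - min (4 * 2 ^ Fintype.card U * 2 ^ Fintype.card V)
            (2 * 2 ^ Fintype.card U * 2 ^ Fintype.card V + 4 * 2 ^ Fintype.card U * (N Tᶜ η : ℤ))) 0 := by
    simp only [sum_sub_distrib, sum_add_distrib, sum_const, nsmul_eq_mul, ← mul_sum, ← sum_mul]
    ring
  rw [R11] at S11
  rw [R10] at S10
  rw [R01] at S01
  rw [eA] at S11
  rw [eB] at S11 S01
  have hcS : (0 : ℤ) ≤ S.card := by positivity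
  have hcT : (0 : ℤ) ≤ Tᶜ.card := by positivity
  have hposE : (0 : ℤ) ≤ 2 * 2 ^ Fintype.card U * S.card := by positivity
  have EX' := EX
  have OB := mul_le_mul_of_nonneg_left obT hposE
  have PS' := mul_le_mul_of_nonneg_left PS (show (0 : ℤ) ≤ 2 ^ Fintype.card U * S.card by positivity)
  rw [eB] at OB
  nlinarith [S11, S10, S01, EX', OB, PS', mul_nonneg (mul_nonneg hX.le hY.le) (mul_nonneg hcS hcT)]

/-! ## §4  The relaxed general core satisfies the grid invariant -/

/-- **THE RELAXED GENERAL CORE**: `Grid4` for `P = [x₀=2]×S×Ω`, `b = [x₀=1]×Ω ∪ [x₀=2]×Sᶜ×Ω`, `Q = Ω×Ω×T`, `c = Ω×Ω×Tᶜ`, all `S, T`. [this work] -/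
theorem grid4_relaxedCore : Grid4 (rcP S) (rcb S) (rcQ T) (rcc T) :=
  grid4_of_fibrewise (fun x : Pt (U ⊕ V) => mRC S T (fstPt x) (sndPt x)) (sum_mRC_nonneg S T)
    fun x JSS JSO JOS JOO u1 u2 u3 u4 n1 n2 n3 n4 f1 f2 f3 => by
      obtain ⟨ξ, η, rfl⟩ : ∃ ξ η, x = Sum.elim ξ η := ⟨fstPt x, sndPt x, (elim_fstPt_sndPt x).symm⟩
      simpa only [fstPt_elim, sndPt_elim] using mRC_le S T ξ η JSS JSO JOS JOO u1 u2 u3 u4 n1 n2 n3 n4 f1 f2 f3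

end inst

/-! ## §5  The family and the theorem -/

/-- **The relaxed-core family**: relaxed general cores, closed under arbitrary up-set factor lifts on either side. [this work] -/
inductive IsRelCorePad : ∀ (κ : Type) [Fintype κ] [DecidableEq κ], Finset (Pt κ) → Finset (Pt κ) → Finset (Pt κ) → Finset (Pt κ) → Prop
  | rccore {U V : Type} [Fintype U] [DecidableEq U] [Fintype V] [DecidableEq V] (S : Finset (Pt U)) (T : Finset (Pt V)) :
      IsRelCorePad (Fin 1 ⊕ (U ⊕ V)) (rcP S) (rcb S) (rcQ T) (rcc T)
  | factorP {W κ : Type} [Fintype W] [DecidableEq W] [Fintype κ] [DecidableEq κ] {A : Finset (Pt W)} (hA : IsUpperSet (A : Set (Pt W)))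
      {P b Q c : Finset (Pt κ)} :
      IsRelCorePad κ P b Q c → IsRelCorePad (W ⊕ κ) (cylL A ∩ cylR P) (cylL A ∩ cylR b) (cylR Q) (cylR c)
  | factorQ {W κ : Type} [Fintype W] [DecidableEq W] [Fintype κ] [DecidableEq κ] {B : Finset (Pt W)} (hB : IsUpperSet (B : Set (Pt W)))
      {P b Q c : Finset (Pt κ)} :
      IsRelCorePad κ P b Q c → IsRelCorePad (W ⊕ κ) (cylR P) (cylR b) (cylL B ∩ cylR Q) (cylL B ∩ cylR c)

/-- `Grid4` on the relaxed-core family. [this work] -/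
theorem grid4_of_isRelCorePad {κ : Type} [Fintype κ] [DecidableEq κ] {P b Q c : Finset (Pt κ)} (h : IsRelCorePad κ P b Q c) : Grid4 P b Q c := by
  induction h with
  | rccore S T => exact grid4_relaxedCore S T
  | factorP hA _ ih => exact grid4_factorP hA ih
  | factorQ hB _ ih => exact grid4_factorQ hB ih

section coreinv
variable {U V : Type} [Fintype U] [DecidableEq U] [Fintype V] [DecidableEq V] (S : Finset (Pt U)) (T : Finset (Pt V))

/-- The core invariants of the relaxed general core. [this work] -/
theorem invariants_rccore :
    Disjoint (rcP S : Finset (Pt (Fin 1 ⊕ (U ⊕ V)))) (rcb S) ∧ Disjoint (rcQ T : Finset (Pt (Fin 1 ⊕ (U ⊕ V)))) (rcc T) ∧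
      Indep (rcP S : Finset (Pt (Fin 1 ⊕ (U ⊕ V)))) (rcQ T) := by
  refine ⟨?_, ?_, ?_⟩
  · rw [rcP, rcb, disjoint_left]
    intro u hu hu'
    rw [mem_inter, mem_cylL, mem_cylR, mem_cylL] at hu
    rw [mem_union, mem_cylL, mem_inter, mem_cylL, mem_cylR, mem_cylL, mem_compl] at hu'
    simp only [lvl, mem_filter, mem_univ, true_and] at hu hu'
    rcases hu' with h1 | h2
    · rw [hu.1] at h1; exact absurd h1 (by decide)
    · exact h2.2 hu.2
  · have e : (rcc T : Finset (Pt (Fin 1 ⊕ (U ⊕ V)))) = (rcQ T)ᶜ := by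
      unfold rcQ rcc
      rw [cylR_compl (U := U) (V := V) T, cylR_compl (U := Fin 1) (V := U ⊕ V) (cylR T)]
    rw [e]; exact disjoint_compl_right
  · intro i
    rcases i with w | k
    · exact Or.inr (axisInessential_cylR_inl _ w)
    · rcases k with u | v
      · exact Or.inr (axisInessential_cylR_inr (axisInessential_cylR_inl T u))
      · exact Or.inl (axisInessential_prod_inr (axisInessential_cylL_inr S v))

end coreinv

/-- The invariants carried along the family: `P ∩ b = ∅`, `Q ∩ c = ∅`, `P ⊥ Q`. [this work] -/
theorem invariants_of_isRelCorePad {κ : Type} [Fintype κ] [DecidableEq κ] {P b Q c : Finset (Pt κ)} (h : IsRelCorePad κ P b Q c) :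
    Disjoint P b ∧ Disjoint Q c ∧ Indep P Q := by
  induction h with
  | rccore S T => exact invariants_rccore S T
  | @factorP W κ _ _ _ _ A hA P b Q c _ ih => exact ⟨disjoint_factor A ih.1, disjoint_cylR ih.2.1, indep_factorP A ih.2.2⟩
  | @factorQ W κ _ _ _ _ B hB P b Q c _ ih => exact ⟨disjoint_cylR ih.1, disjoint_factor B ih.2.1, (indep_factorP B ih.2.2.symm).symm⟩

/-- **TOP-SLICE DOMINANCE WITH THE SHARP CONSTANT `3/2` ON THE RELAXED-CORE FAMILY** (threshold-relaxed literal + private cut; every dimension): for every member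
`(P, b, Q, c)` of `IsRelCorePad` and every up-set `F ⊇ P ∪ Q`,
`3 · κ(F, P ∪ b, Q ∪ c) ≤ 2 · κ(ofSections F F F, ofSections P P (P ∪ b), ofSections Q Q (Q ∪ c))`. [this work] -/
theorem three_kappa_top_le_two_kappa_lowerStep_of_isRelCorePad {κ : Type} [Fintype κ] [DecidableEq κ] {P b Q c : Finset (Pt κ)}
    (h : IsRelCorePad κ P b Q c) {F : Finset (Pt κ)} (hF : IsUpperSet (F : Set (Pt κ))) (hPQ : P ∪ Q ⊆ F) :
    3 * kappa F (P ∪ b) (Q ∪ c) ≤ 2 * kappa (ofSections F F F) (ofSections P P (P ∪ b)) (ofSections Q Q (Q ∪ c)) := by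
  obtain ⟨hPb, hQc, hI⟩ := invariants_of_isRelCorePad h
  have h0 : kappa F P Q = 0 := kappa_eq_zero_of_indep_of_union_subset hI hPQ
  have hb : (P ∪ b) \ P = b := by
    rw [union_sdiff_left, Finset.sdiff_eq_self_iff_disjoint]; exact hPb.symm
  have hc : (Q ∪ c) \ Q = c := by
    rw [union_sdiff_left, Finset.sdiff_eq_self_iff_disjoint]; exact hQc.symm
  have key := (three_kappa_top_le_iff_psi_nonneg (F := F) (subset_union_left (s₁ := P) (s₂ := b))
    (subset_union_left (s₁ := Q) (s₂ := c)) h0).2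
  rw [hb, hc] at key
  exact key (psi_nonneg_of_grid4 (grid4_of_isRelCorePad h) hF hPQ)

end Summit.CriticalPhenomena.PercolationContinuityZ3.Theorems.SahiLatin
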